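import Summits.BirchSwinnertonDyer.BirchSwinnertonDyer.Theorems.PrintCf2SplitBadTwoRestrictedSelmerLeadingTerm
import HarnessLib

/-!
# Crux `PrintCf2.SplitBadTwoRankOneOfFacts` (stmt-BirchSwinnertonDyer-20368), road α v9 — brick B5‴ (capstone of B5/B5′/B5″):
# S3c `stub_restrictedControl_two` MODULO FOUR NAMED INDICES — `ord_p H(0) = v_p #𝔖_𝔮(K, M) + v_p coker − v_p ker − v_p #H¹(Γ, 𝔖)`

Cell `bsd-print-cf2`, width seat `bsd-line-cf2-p1-w7` g0; `--supports stmt-BirchSwinnertonDyer-20368` (helper, Theses-free).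
HONEST FRAMING: nothing here closes a crux or a stub; BSD is not proved by any of this; no summit statement is proved by
this seat. No definition, no named fact, no `sorry`. Fourth file of the seat's descent skeleton for road α's algebraic half:
TOP `…RestrictedSelmerLeadingTerm` (p651541, on LEAD g10's `Agboola2007/RestrictedSelmerDualProofs`) → CONTROL
`…RestrictedSelmerControlSkeleton` (p649994) → BOTTOM `…RestrictedSelmerPair{Skeleton,Base}` (p648601 / p649193).

WHAT IS PROVED (generic: `K` number field, `κ` a `ℤ_p`-extension with topological generator `γ`, `M` a discrete
`Γ_K`-module, `𝔮` a place; `𝔖 = 𝔖_𝔮(K_∞, M) = Agboola2007.restrictedSelmerZp κ M 𝔮`, `Γ` acting by `conj_γ`,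
`𝔖_𝔮(K, M) = Agboola2007.restrictedSelmerBase M p 𝔮`, `res` the bottom control map of B5′):
* `image_le_endInvariants` — `res(𝔖_𝔮(K, M)) ≤ 𝔖^Γ`;
* `card_restrictedSelmerBase_eq_card_ker_mul_card_image` — `#𝔖_𝔮(K, M) = #ker · #res(𝔖_𝔮(K, M))`,
  `ker = 𝔖_𝔮(K, M) ∩ ker (H¹(K, M) → H¹(K_∞, M))`;
* `card_endInvariants_eq_card_image_mul_relIndex` — `#𝔖^Γ = #res(𝔖_𝔮(K, M)) · [𝔖^Γ : res(𝔖_𝔮(K, M))]`;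
* `finite_ker_resOfLe_le_top` — `ker (H¹(K, M) → H¹(K_∞, M))` is finite when `M^{H_∞}/(γ − 1)` is (B5′ at `n = 0`);
* `finite_endInvariants_of_finite_restrictedSelmerBase`, `control_identity_of_pow_mul_natCard` (appended): the same two
  statements in the currency of v9.1's S3c₂ `stub_restrictedEulerCharBottom_two` — «`Finite 𝔖^Γ`» ⟸ `𝔖_𝔮(K, M)` finite ∧ control
  cokernel finite; and from `p^n · #𝔖_Γ = u · #𝔖^Γ` (no dual datum) the four-index identity below;
* `hasCharValuationAt_control_identity` — **for `D : RestrictedDualData κ M 𝔮 γ` with `D.HasCharValuationAt n` (S3c's displayed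
  hypothesis), `D.X` finitely generated, `M` `p`-primary with open stabilisers and continuous orbit maps, `M^{H_∞}/(γ − 1)`
  finite: `𝔖^Γ`, `𝔖_Γ`, `𝔖_𝔮(K, M)`, `ker` are finite and
  `n + v_p #𝔖_Γ + v_p #ker = v_p #𝔖_𝔮(K, M) + v_p [𝔖^Γ : res 𝔖_𝔮(K, M)]`.**
So, for road α (`K₀`, `p = 2`, `κ*`, `M = W* = ↥((W.baseChange K₀).endEigenPrimaryTorsion 2 π r)`, `𝔮 = v̄`), v9's S3c is the
statement that the four VALUES `v₂ #𝔖_{v̄}(K₀, W*)`, `v₂ [𝔖^Γ : res]` (local by B5′), `v₂ #ker` (`≤ v₂ #(W*(K*_∞)/(γ − 1))` by B5′),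
`v₂ #H¹(Γ, 𝔖)` combine to `ord₂ #Ш(W/ℚ)[2^∞] + ord₂ ∏c_ℓ − 2 ord₂ #W(ℚ)_tors + 2ℓ + e_C([d]₂)` — Agboola §6 / Prop. 8.1 (Poitou–Tate,
`#𝔖_{𝔭*}(K, W*) ↔ #Ш(K)(𝔭*) · [E(K_{𝔭*}) ⊗ : loc]`), §5 (`#𝔖_Γ`), the additive-`2` local kernels, and the `K ↔ ℚ` / dyadic
repackaging (B4/B6, B2/B7): VALUES, not skeletons — not here. presearch: not applicable (no stub, no fact filed).

References: A. Agboola, Compositio Math. 143 (2007) = arXiv:math/0602192, §3 Prop. 3.2, §5, §6, Prop. 8.1, Thm. 2 [Agboola2007];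
R. Greenberg, LNM 1716 (1999) §3 Lemmas 3.1–3.2, §4 Lemma 4.2 [GreenbergLNM1716].
-/

noncomputable section

open scoped Classical

set_option linter.dupNamespace false
set_option autoImplicit false

open NumberField IsDedekindDomain Field
open Literature.NumberTheory.EllipticCurves Literature.NumberTheory.EllipticCurves.GreenbergSelmer
open Literature.NumberTheory.EllipticCurves.Agboola2007
open Literature.NumberTheory.EllipticCurves.IwasawaAlgebra
open Literature.NumberTheory.EllipticCurves.IwasawaDual
open Literature.NumberTheory.EllipticCurves.ResKernel
open Literature.NumberTheory.GaloisRepresentations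

universe u

namespace Summit.BirchSwinnertonDyer.BirchSwinnertonDyer.Theorems.PrintCf2.RestrictedSelmerPair

section Index

variable {K : Type u} [Field K] [NumberField K] {p : ℕ} [Fact p.Prime] (κ : ZpExtension K p)
  (M : Type u) [AddCommGroup M] [DistribMulAction (absoluteGaloisGroup K) M]
  [TopologicalSpace M] [DiscreteTopology M] (𝔮 : HeightOneSpectrum (𝓞 K)) (γ : absoluteGaloisGroup K)

/-- **The image of the bottom control map lies in `𝔖_𝔮(K_∞, M)^Γ`**: `res(𝔖_𝔮(K, M)) ≤ H⁰(Γ, 𝔖_𝔮(K_∞, M))`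
(as subgroups of `𝔖_𝔮(K_∞, M)`; `conjH1_resOfLe_of_mem`). [cite: Agboola2007, §3 Prop. 3.2, §5 (arXiv p0012:L8–16)]
[cite: GreenbergLNM1716, §3 (the maps `s_n`)] -/
theorem image_le_endInvariants :
    ((restrictedSelmerBase M p 𝔮).map (resOfLe M (le_top : κ.kerSubgroup ≤ ⊤))).addSubgroupOf
        (restrictedSelmerZp κ M 𝔮) ≤
      endInvariants (conjRestricted κ M 𝔮 γ - 1) := by
  intro x hx
  obtain ⟨c, hc, hcx⟩ := AddSubgroup.mem_addSubgroupOf.mp hx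
  rw [mem_endInvariants_conjRestricted_iff, ← hcx]
  exact conjH1_resOfLe_of_mem M (le_top : κ.kerSubgroup ≤ ⊤) (Subgroup.mem_top γ) c

/-- **`#𝔖_𝔮(K, M) = #ker · #image`** for the bottom control map `res : 𝔖_𝔮(K, M) → 𝔖_𝔮(K_∞, M)`, with
`ker = 𝔖_𝔮(K, M) ∩ ker (H¹(K, M) → H¹(K_∞, M))` and `image = res(𝔖_𝔮(K, M))` viewed inside `𝔖_𝔮(K_∞, M)` (Lagrange +
first isomorphism theorem; `Nat.card`). [cite: Agboola2007, §3 Prop. 3.2] [cite: GreenbergLNM1716, §3 Lemma 3.1] -/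
theorem card_restrictedSelmerBase_eq_card_ker_mul_card_image :
    Nat.card (restrictedSelmerBase M p 𝔮) =
      Nat.card ↥(restrictedSelmerBase M p 𝔮 ⊓ (resOfLe M (le_top : κ.kerSubgroup ≤ ⊤)).ker) *
        Nat.card (((restrictedSelmerBase M p 𝔮).map (resOfLe M (le_top : κ.kerSubgroup ≤ ⊤))).addSubgroupOf
          (restrictedSelmerZp κ M 𝔮)) := by
  set f := (resOfLe M (le_top : κ.kerSubgroup ≤ ⊤)).comp (restrictedSelmerBase M p 𝔮).subtype with hf
  have hker : f.ker = (restrictedSelmerBase M p 𝔮 ⊓ (resOfLe M (le_top : κ.kerSubgroup ≤ ⊤)).ker).addSubgroupOf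
      (restrictedSelmerBase M p 𝔮) := by
    ext c
    rw [AddMonoidHom.mem_ker, hf, AddMonoidHom.comp_apply, AddSubgroup.mem_addSubgroupOf,
      AddSubgroup.mem_inf, AddSubgroup.coe_subtype, AddMonoidHom.mem_ker]
    exact ⟨fun h ↦ ⟨c.2, h⟩, fun h ↦ h.2⟩
  have hrange : f.range = (restrictedSelmerBase M p 𝔮).map (resOfLe M (le_top : κ.kerSubgroup ≤ ⊤)) := by
    rw [hf, AddMonoidHom.range_comp, AddSubgroup.range_subtype]
  have hle : (restrictedSelmerBase M p 𝔮).map (resOfLe M (le_top : κ.kerSubgroup ≤ ⊤)) ≤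
      restrictedSelmerZp κ M 𝔮 := map_resOfLe_restrictedSelmer_le M p 𝔮 le_top
  rw [AddSubgroup.card_eq_card_quotient_mul_card_addSubgroup f.ker,
    Nat.card_congr (QuotientAddGroup.quotientKerEquivRange f).toEquiv, hker, hrange,
    Nat.card_congr (AddSubgroup.addSubgroupOfEquivOfLe
      (inf_le_left : restrictedSelmerBase M p 𝔮 ⊓ (resOfLe M (le_top : κ.kerSubgroup ≤ ⊤)).ker ≤ _)).toEquiv,
    Nat.card_congr (AddSubgroup.addSubgroupOfEquivOfLe hle).toEquiv, mul_comm]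

/-- **`#𝔖_𝔮(K_∞, M)^Γ = #image · [𝔖^Γ : image]`** — the COKERNEL INDEX of control as a relative index
(`AddSubgroup.relIndex`; Lagrange in `𝔖^Γ`). [cite: Agboola2007, §3 Prop. 3.2, §5] [cite: GreenbergLNM1716, §3 Lemma 3.2] -/
theorem card_endInvariants_eq_card_image_mul_relIndex :
    Nat.card (endInvariants (conjRestricted κ M 𝔮 γ - 1)) =
      Nat.card (((restrictedSelmerBase M p 𝔮).map (resOfLe M (le_top : κ.kerSubgroup ≤ ⊤))).addSubgroupOf
          (restrictedSelmerZp κ M 𝔮)) *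
        (((restrictedSelmerBase M p 𝔮).map (resOfLe M (le_top : κ.kerSubgroup ≤ ⊤))).addSubgroupOf
          (restrictedSelmerZp κ M 𝔮)).relIndex (endInvariants (conjRestricted κ M 𝔮 γ - 1)) := by
  have hle := image_le_endInvariants κ M 𝔮 γ
  rw [AddSubgroup.relIndex, ← Nat.card_congr (AddSubgroup.addSubgroupOfEquivOfLe hle).toEquiv,
    AddSubgroup.card_mul_index]

/-- **The kernel of the bottom restriction `H¹(K, M) → H¹(K_∞, M)` is finite** when `M^{H_∞}/(γ − 1)M^{H_∞}` is
(and `M` has continuous orbit maps): brick B5′ `finite_ker_resOfLe_and_card_le` at `n = 0`, transported along the invertible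
restriction `H¹(⊤, M) → H¹(H_0, M)` (`resOfLe_layer_zero_leftInverse`, `ZpExtension.layerSubgroup_zero`).
[cite: GreenbergLNM1716, §3 Lemma 3.1 (p. 86)] -/
theorem finite_ker_resOfLe_le_top (hγ : κ.IsTopGenerator γ)
    (hcont : ∀ m : M, Continuous fun g : absoluteGaloisGroup K ↦ g • m)
    [hfin : Finite (FixedPoints.addSubgroup κ.kerSubgroup M ⧸ (subOne κ.kerSubgroup M γ).range)] :
    Finite (resOfLe M (le_top : κ.kerSubgroup ≤ ⊤)).ker := by
  haveI : Finite (FixedPoints.addSubgroup κ.kerSubgroup M ⧸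
      (subOne κ.kerSubgroup M (γ ^ p ^ 0)).range) := by
    simpa only [pow_zero, pow_one] using hfin
  obtain ⟨hK0, -⟩ := finite_ker_resOfLe_and_card_le κ M 0 hγ hcont
  let ι : (resOfLe M (le_top : κ.kerSubgroup ≤ ⊤)).ker →
      (resOfLe M (κ.kerSubgroup_le_layerSubgroup 0)).ker := fun c ↦
    ⟨resOfLe M (le_top : κ.layerSubgroup 0 ≤ ⊤) c, by
      rw [AddMonoidHom.mem_ker, ← AddMonoidHom.comp_apply, resOfLe_comp_holds]
      exact c.2⟩
  have hι : Function.Injective ι := fun a b hab ↦ by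
    have h1 : (ι a).1 = (ι b).1 := congrArg Subtype.val hab
    exact Subtype.ext ((resOfLe_layer_zero_leftInverse κ M).injective h1)
  exact Finite.of_injective ι hι

/-- **S3c MODULO FOUR NAMED INDICES.** For Agboola's dual datum `D = X_𝔮(K_∞, M)` (`RestrictedDualData κ M 𝔮 γ`; `M`
`p`-primary with open stabilisers and continuous orbit maps, `γ` a topological generator, `M^{H_∞}/(γ − 1)` finite, `D.X`
finitely generated over `Λ`) satisfying S3c's displayed hypothesis `D.HasCharValuationAt n`: the four groups
`𝔖^Γ = H⁰(Γ, 𝔖_𝔮(K_∞, M))`, `𝔖_Γ = H¹(Γ, 𝔖_𝔮(K_∞, M))`, `𝔖_𝔮(K, M)` and `ker = 𝔖_𝔮(K, M) ∩ ker (H¹(K, M) → H¹(K_∞, M))`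
are FINITE and
**`n + v_p #𝔖_Γ + v_p #ker = v_p #𝔖_𝔮(K, M) + v_p [𝔖^Γ : res 𝔖_𝔮(K, M)]`**
— i.e. `ord_p H(0) = v_p #𝔖_𝔮(K, M) + v_p(coker of control) − v_p(ker of control) − v_p #H¹(Γ, 𝔖_𝔮(K_∞, M))`
(Euler characteristic `padicValNat_card_endInvariants_of_hasCharValuationAt` + Lagrange twice). For road α (`K = K₀`,
`p = 2`, `κ*`, `M = W* = E[𝔭̄₀^∞]`, `𝔮 = 𝔭̄₀`) this is v9's `stub_restrictedControl_two` REDUCED to the VALUES of: `#𝔖_{𝔭*}(K, W*)`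
(Agboola §6 / Prop. 8.1: `#Ш(K)(𝔭*) · [E(K_{𝔭*}) ⊗ : loc]`, Poitou–Tate — not in the tree), the cokernel index (LOCAL by B5′
`resOfLe_local_lift_eq_zero`), the kernel (`≤ #W*(K*_∞)/(γ − 1)` by B5′) and `#H¹(Γ, 𝔖)` (Agboola §5) — plus the `K ↔ ℚ` and
dyadic repackaging (B4/B6, B2/B7). [cite: Agboola2007, §5, §6, Prop. 8.1 (arXiv p0017:L17–28), Thm. 2] [cite: GreenbergLNM1716, §3–§4] -/
theorem hasCharValuationAt_control_identity (D : RestrictedDualData κ M 𝔮 γ)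
    (htor : ∀ m : M, ∃ k : ℕ, p ^ k • m = 0)
    (hstab : ∀ m : M, IsOpen (MulAction.stabilizer (absoluteGaloisGroup K) m : Set (absoluteGaloisGroup K)))
    (hγ : κ.IsTopGenerator γ) (hcont : ∀ m : M, Continuous fun g : absoluteGaloisGroup K ↦ g • m)
    [Finite (FixedPoints.addSubgroup κ.kerSubgroup M ⧸ (subOne κ.kerSubgroup M γ).range)]
    [Module.Finite (IwasawaAlgebra p) D.X] {n : ℕ} (h : D.HasCharValuationAt n) :
    Finite (endInvariants (conjRestricted κ M 𝔮 γ - 1)) ∧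
    Finite (EndCoinvariants (conjRestricted κ M 𝔮 γ - 1)) ∧
    Finite (restrictedSelmerBase M p 𝔮) ∧
    Finite ↥(restrictedSelmerBase M p 𝔮 ⊓ (resOfLe M (le_top : κ.kerSubgroup ≤ ⊤)).ker) ∧
      n + padicValNat p (Nat.card (EndCoinvariants (conjRestricted κ M 𝔮 γ - 1))) +
          padicValNat p (Nat.card ↥(restrictedSelmerBase M p 𝔮 ⊓ (resOfLe M (le_top : κ.kerSubgroup ≤ ⊤)).ker)) =
        padicValNat p (Nat.card (restrictedSelmerBase M p 𝔮)) +
          padicValNat p ((((restrictedSelmerBase M p 𝔮).map (resOfLe M (le_top : κ.kerSubgroup ≤ ⊤))).addSubgroupOf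
            (restrictedSelmerZp κ M 𝔮)).relIndex (endInvariants (conjRestricted κ M 𝔮 γ - 1))) := by
  obtain ⟨hfinI, hfinC⟩ := finite_endInvariants_of_hasCharValuationAt D htor hstab hγ h
  have hval := padicValNat_card_endInvariants_of_hasCharValuationAt D htor hstab hγ h
  have hK : Finite ↥(restrictedSelmerBase M p 𝔮 ⊓ (resOfLe M (le_top : κ.kerSubgroup ≤ ⊤)).ker) := by
    haveI := finite_ker_resOfLe_le_top κ M γ hγ hcont
    exact Finite.of_injective
      (AddSubgroup.inclusion (inf_le_right : restrictedSelmerBase M p 𝔮 ⊓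
        (resOfLe M (le_top : κ.kerSubgroup ≤ ⊤)).ker ≤ _))
      (AddSubgroup.inclusion_injective _)
  -- the image R ≤ I is finite
  have hle := image_le_endInvariants κ M 𝔮 γ
  haveI := hfinI
  haveI := hfinC
  haveI := hK
  have hR : Finite (((restrictedSelmerBase M p 𝔮).map (resOfLe M (le_top : κ.kerSubgroup ≤ ⊤))).addSubgroupOf
      (restrictedSelmerZp κ M 𝔮)) :=
    Finite.of_injective (AddSubgroup.inclusion hle) (AddSubgroup.inclusion_injective hle)
  haveI := hR
  have h2 := card_restrictedSelmerBase_eq_card_ker_mul_card_image κ M 𝔮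
  have h3 := card_endInvariants_eq_card_image_mul_relIndex κ M 𝔮 γ
  -- all the cardinals are non-zero
  have hI0 : Nat.card (endInvariants (conjRestricted κ M 𝔮 γ - 1)) ≠ 0 := Nat.card_pos.ne'
  have hK0 : Nat.card ↥(restrictedSelmerBase M p 𝔮 ⊓ (resOfLe M (le_top : κ.kerSubgroup ≤ ⊤)).ker) ≠ 0 :=
    Nat.card_pos.ne'
  have hR0 : Nat.card (((restrictedSelmerBase M p 𝔮).map (resOfLe M (le_top : κ.kerSubgroup ≤ ⊤))).addSubgroupOf
      (restrictedSelmerZp κ M 𝔮)) ≠ 0 := Nat.card_pos.ne'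
  have hB0 : Nat.card (restrictedSelmerBase M p 𝔮) ≠ 0 := by rw [h2]; exact mul_ne_zero hK0 hR0
  have hBfin : Finite (restrictedSelmerBase M p 𝔮) := Nat.finite_of_card_ne_zero hB0
  have hidx0 : (((restrictedSelmerBase M p 𝔮).map (resOfLe M (le_top : κ.kerSubgroup ≤ ⊤))).addSubgroupOf
      (restrictedSelmerZp κ M 𝔮)).relIndex (endInvariants (conjRestricted κ M 𝔮 γ - 1)) ≠ 0 := by
    intro h0
    rw [h0, mul_zero] at h3
    exact hI0 h3
  refine ⟨hfinI, hfinC, hBfin, hK, ?_⟩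
  have e2 := congrArg (padicValNat p) h2
  have e3 := congrArg (padicValNat p) h3
  rw [padicValNat.mul hK0 hR0] at e2
  rw [padicValNat.mul hR0 hidx0] at e3
  omega

/-! ### The same identity in the currency of v9.1's S3c₂ `stub_restrictedEulerCharBottom_two` (no dual datum) -/

/-- **`𝔖^Γ` is finite as soon as `𝔖_𝔮(K, M)` is finite and the control cokernel `[𝔖^Γ : res 𝔖_𝔮(K, M)]` is finite**
(`relIndex ≠ 0`): the first conjunct «`Finite 𝔖^Γ`» of v9.1's S3c₂ `stub_restrictedEulerCharBottom_two` REDUCED to two named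
finiteness values (bottom group: Agboola §6 in analytic rank one; cokernel: the local kernels of B5′ `resOfLe_local_lift_eq_zero`).
[cite: Agboola2007, §3 Prop. 3.2, §6] [cite: GreenbergLNM1716, §3] -/
theorem finite_endInvariants_of_finite_restrictedSelmerBase (hB : Finite (restrictedSelmerBase M p 𝔮))
    (hidx : (((restrictedSelmerBase M p 𝔮).map (resOfLe M (le_top : κ.kerSubgroup ≤ ⊤))).addSubgroupOf
        (restrictedSelmerZp κ M 𝔮)).relIndex (endInvariants (conjRestricted κ M 𝔮 γ - 1)) ≠ 0) :
    Finite (endInvariants (conjRestricted κ M 𝔮 γ - 1)) := by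
  haveI := hB
  have hR : Finite (((restrictedSelmerBase M p 𝔮).map (resOfLe M (le_top : κ.kerSubgroup ≤ ⊤))).addSubgroupOf
      (restrictedSelmerZp κ M 𝔮)) := by
    haveI : Finite ((restrictedSelmerBase M p 𝔮).map (resOfLe M (le_top : κ.kerSubgroup ≤ ⊤))) :=
      Finite.of_surjective
        (fun c : restrictedSelmerBase M p 𝔮 ↦
          (⟨resOfLe M (le_top : κ.kerSubgroup ≤ ⊤) c, ⟨c, c.2, rfl⟩⟩ :
            (restrictedSelmerBase M p 𝔮).map (resOfLe M (le_top : κ.kerSubgroup ≤ ⊤))))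
        (by rintro ⟨_, c, hc, rfl⟩; exact ⟨⟨c, hc⟩, rfl⟩)
    exact Finite.of_equiv _ (AddSubgroup.addSubgroupOfEquivOfLe
      (map_resOfLe_restrictedSelmer_le M p 𝔮 (le_top : κ.kerSubgroup ≤ ⊤))).toEquiv.symm
  haveI := hR
  have hR0 : Nat.card (((restrictedSelmerBase M p 𝔮).map (resOfLe M (le_top : κ.kerSubgroup ≤ ⊤))).addSubgroupOf
      (restrictedSelmerZp κ M 𝔮)) ≠ 0 := Nat.card_pos.ne'
  have h3 := card_endInvariants_eq_card_image_mul_relIndex κ M 𝔮 γ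
  exact Nat.finite_of_card_ne_zero (by rw [h3]; exact mul_ne_zero hR0 hidx)

/-- **S3c₂ MODULO FOUR NAMED INDICES, in its own currency.** With the binders of v9.1's `stub_restrictedEulerCharBottom_two` —
`𝔖^Γ` finite and `p^n · #𝔖_Γ = u · #𝔖^Γ` for a unit `u` (no dual datum, no characteristic ideal) — and the side conditions
of B5′ (continuous orbit maps of `M`, `M^{H_∞}/(γ − 1)M^{H_∞}` finite): `𝔖_Γ`, `𝔖_𝔮(K, M)` and `ker = 𝔖_𝔮(K, M) ∩ ker (H¹(K, M) →
H¹(K_∞, M))` are finite and **`n + v_p #𝔖_Γ + v_p #ker = v_p #𝔖_𝔮(K, M) + v_p [𝔖^Γ : res 𝔖_𝔮(K, M)]`** — the conclusion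
`(n : ℤ) = ord₂ #Ш(W/ℚ)[2^∞] + …` of S3c₂ is thereby the statement about the four VALUES `v₂ #𝔖_{v̄}(K₀, W*)` (Agboola §6 /
Prop. 8.1), `v₂ [𝔖^Γ : res]` (control cokernel, local), `v₂ #ker` (`≤ v₂ #(W*(K*_∞)/(γ − 1))`), `v₂ #H¹(Γ, 𝔖)` (Agboola §5).
[cite: Agboola2007, §5, §6, Prop. 8.1 (arXiv p0017:L17–28)] [cite: GreenbergLNM1716, §3 Lemmas 3.1–3.2, §4 Lemma 4.2] -/
theorem control_identity_of_pow_mul_natCard (hγ : κ.IsTopGenerator γ)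
    (hcont : ∀ m : M, Continuous fun g : absoluteGaloisGroup K ↦ g • m)
    [Finite (FixedPoints.addSubgroup κ.kerSubgroup M ⧸ (subOne κ.kerSubgroup M γ).range)]
    [hfinI : Finite (endInvariants (conjRestricted κ M 𝔮 γ - 1))] {n : ℕ} {u : ℤ_[p]ˣ}
    (hu : (p : ℤ_[p]) ^ n * (Nat.card (EndCoinvariants (conjRestricted κ M 𝔮 γ - 1)) : ℤ_[p]) =
      u * Nat.card (endInvariants (conjRestricted κ M 𝔮 γ - 1))) :
    Finite (EndCoinvariants (conjRestricted κ M 𝔮 γ - 1)) ∧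
    Finite (restrictedSelmerBase M p 𝔮) ∧
    Finite ↥(restrictedSelmerBase M p 𝔮 ⊓ (resOfLe M (le_top : κ.kerSubgroup ≤ ⊤)).ker) ∧
      n + padicValNat p (Nat.card (EndCoinvariants (conjRestricted κ M 𝔮 γ - 1))) +
          padicValNat p (Nat.card ↥(restrictedSelmerBase M p 𝔮 ⊓ (resOfLe M (le_top : κ.kerSubgroup ≤ ⊤)).ker)) =
        padicValNat p (Nat.card (restrictedSelmerBase M p 𝔮)) +
          padicValNat p ((((restrictedSelmerBase M p 𝔮).map (resOfLe M (le_top : κ.kerSubgroup ≤ ⊤))).addSubgroupOf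
            (restrictedSelmerZp κ M 𝔮)).relIndex (endInvariants (conjRestricted κ M 𝔮 γ - 1))) := by
  have hI0 : Nat.card (endInvariants (conjRestricted κ M 𝔮 γ - 1)) ≠ 0 := Nat.card_pos.ne'
  -- `𝔖_Γ` is finite: otherwise the left-hand side of `hu` vanishes and the right-hand side does not
  have hC0 : Nat.card (EndCoinvariants (conjRestricted κ M 𝔮 γ - 1)) ≠ 0 := by
    intro h0
    rw [h0, Nat.cast_zero, mul_zero] at hu
    exact (mul_ne_zero u.ne_zero (Nat.cast_ne_zero.mpr hI0)) hu.symm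
  have hfinC : Finite (EndCoinvariants (conjRestricted κ M 𝔮 γ - 1)) := Nat.finite_of_card_ne_zero hC0
  have hp0 : ((p : ℤ_[p]) ^ n) ≠ 0 := pow_ne_zero _ (NeZero.ne _)
  have hval := padicValNat_eq_of_mul_natCast_eq hC0 hI0 hp0 hu
  rw [PadicInt.valuation_pow, PadicInt.valuation_p, mul_one] at hval
  have hK : Finite ↥(restrictedSelmerBase M p 𝔮 ⊓ (resOfLe M (le_top : κ.kerSubgroup ≤ ⊤)).ker) := by
    haveI := finite_ker_resOfLe_le_top κ M γ hγ hcont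
    exact Finite.of_injective
      (AddSubgroup.inclusion (inf_le_right : restrictedSelmerBase M p 𝔮 ⊓
        (resOfLe M (le_top : κ.kerSubgroup ≤ ⊤)).ker ≤ _))
      (AddSubgroup.inclusion_injective _)
  have hle := image_le_endInvariants κ M 𝔮 γ
  haveI := hK
  have hR : Finite (((restrictedSelmerBase M p 𝔮).map (resOfLe M (le_top : κ.kerSubgroup ≤ ⊤))).addSubgroupOf
      (restrictedSelmerZp κ M 𝔮)) :=
    Finite.of_injective (AddSubgroup.inclusion hle) (AddSubgroup.inclusion_injective hle)
  haveI := hR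
  have h2 := card_restrictedSelmerBase_eq_card_ker_mul_card_image κ M 𝔮
  have h3 := card_endInvariants_eq_card_image_mul_relIndex κ M 𝔮 γ
  have hK0 : Nat.card ↥(restrictedSelmerBase M p 𝔮 ⊓ (resOfLe M (le_top : κ.kerSubgroup ≤ ⊤)).ker) ≠ 0 :=
    Nat.card_pos.ne'
  have hR0 : Nat.card (((restrictedSelmerBase M p 𝔮).map (resOfLe M (le_top : κ.kerSubgroup ≤ ⊤))).addSubgroupOf
      (restrictedSelmerZp κ M 𝔮)) ≠ 0 := Nat.card_pos.ne'
  have hB0 : Nat.card (restrictedSelmerBase M p 𝔮) ≠ 0 := by rw [h2]; exact mul_ne_zero hK0 hR0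
  have hBfin : Finite (restrictedSelmerBase M p 𝔮) := Nat.finite_of_card_ne_zero hB0
  have hidx0 : (((restrictedSelmerBase M p 𝔮).map (resOfLe M (le_top : κ.kerSubgroup ≤ ⊤))).addSubgroupOf
      (restrictedSelmerZp κ M 𝔮)).relIndex (endInvariants (conjRestricted κ M 𝔮 γ - 1)) ≠ 0 := by
    intro h0
    rw [h0, mul_zero] at h3
    exact hI0 h3
  refine ⟨hfinC, hBfin, hK, ?_⟩
  have e2 := congrArg (padicValNat p) h2
  have e3 := congrArg (padicValNat p) h3
  rw [padicValNat.mul hK0 hR0] at e2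
  rw [padicValNat.mul hR0 hidx0] at e3
  omega

end Index

end Summit.BirchSwinnertonDyer.BirchSwinnertonDyer.Theorems.PrintCf2.RestrictedSelmerPair

end
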